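import Summits.ResolutionOfSingularities.ResolutionOfSingularities.Theorems.FrobeniusClosingPatchingRelPerfectTwoPlanesLevelTwoIdeals
import Summits.ResolutionOfSingularities.ResolutionOfSingularities.Theorems.FrobeniusClosingPatchingRelPerfectConeCubeLevelTwo
import Summits.ResolutionOfSingularities.ResolutionOfSingularities.Theorems.FrobeniusClosingPatchingRelPerfectLetterTowerTwoAny
import Literature.AlgebraicGeometry.Resolution.BlowupPointSubalgebra
import HarnessLib

/-!
# Crux `PatchingRelPerfect` (stmt-ResolutionOfSingularities-16161), chain w52 — the rank-two member
# `f = x₀x₁ + x₂³`: the `s`-chart of the plane blow-up (two-letter tower `(h″; w)`)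

[OURS · L1 W5.2 · rung, DESIGN STAGE → second regularity brick] Companion of `…TwoPlanesLevelTwo`
(the `t`-chart).  Same abstract setting (`A`, plane centre `Π₀ = V(u, e₀)`, `H = e₀ y + u z`); on the
`u`-chart `C₀` of `Bl_{(u, e₀)} Spec A` (`u ↦ w₀`, `e₀ = w₀ s`) the strict transform of `H` is
`h″ = s ψ₀ y + ψ₀ z` and the three companion factors map to `(w₀)`, `(w₀)(h″, w₀)`, `(w₀)(h″, w₀)`
(`…TwoPlanesLevelTwoIdeals`), i.e. to `(w₀)³ · (h″, w₀)(h″, w₀·1)` — a two-letter flag with the word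
`(w₀, 1)`.  By `isRegular_of_isBlowup_letterTower_two''` its blow-ups are regular as soon as `C₀` is a
regular domain, `(h″, w₀)` is quasi-regular and `C₀/(h″, w₀)` is regular; through the exceptional-divisor
model `C₀/(w₀) ≅ (A/(u,e₀))[S]` (`chartQuotEquiv`, `h″ ↦ S ȳ + z̄`) the last two reduce to
`S ȳ + z̄ ≠ 0` and `(A/(u,e₀))[S]/(S ȳ + z̄)` regular — hypotheses here, true on `B₁`, `B₂`
(`z̄ = ē₂³` resp. `1` with `ȳ` a variable resp. `1`), FALSE on `B₃` (`S ē₁ + ē₂³`: the `A₂` surface of the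
design note, which needs further centres):

* `chartQuotEquiv_hFlat`, `h_notMem_span_w`, `nonempty_quot_span_h_w_equiv`,
  `isRegularRing_quot_span_h_w`, `isWeaklyRegular_h_w`;
* `isRegular_of_isBlowup_sFlag` (any word in `{w₀, 1}`), `map_tpProd_s`, `isRegular_of_isBlowup_tpProd_s`.

Nothing here is a statement of the manuscript under review.

## References

* The Stacks Project, Tags 080A, 080B, 0804, 0BIQ. [StacksProject]
* Q. Liu, *Algebraic Geometry and Arithmetic Curves*, OUP 2002, Thm. 8.1.19 (a). [Liu2002]
* H. Matsumura, *Commutative Ring Theory*, CUP 1986, Thm. 16.2 (i). [Matsumura1987]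
-/

-- `Summit.<Summit>.<Sub>.Theorems` with `Sub = Summit` (single-conjunct summit, D-0017)
set_option linter.dupNamespace false

noncomputable section

open CategoryTheory CategoryTheory.Limits AlgebraicGeometry Literature.AlgebraicGeometry.Resolution
open IsLocalRing

namespace Summit.ResolutionOfSingularities.ResolutionOfSingularities.Theorems

namespace TwoPlanesRung

open ConeRung

universe u

/-- Reordering the three twisted factors of the `s`-chart. [folklore] -/
theorem tp_flag_product_s {B : Type*} [CommRing B] (W P : Ideal B) :
    W * (W * P) * (W * P) = W ^ 3 * (P * P) := by
  ring

/-- Letters of the word `(a, 1)`. [folklore] -/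
theorem tp_letters_spec_s {B : Type*} [One B] (a : B) (r : ℕ) :
    [a, 1].getD r 1 = a ∨ [a, 1].getD r 1 = 1 := by
  rcases r with _ | _ | r <;> simp

/-- `1 ≠ 0` in `Fin 2` (index of the variable `s = e₀/u`). [folklore] -/
theorem one_ne_zero_fin2 : (1 : Fin 2) ≠ 0 := by decide

/-- The flag of the word `(a, 1)`: `∏_{s<2} (c, L₀⋯L_s) = (c, a)(c, a)`. [folklore] -/
theorem tp_flag_two {B : Type*} [CommRing B] (c a : B) :
    ∏ s ∈ Finset.range 2, Ideal.span {c, ∏ r ∈ Finset.range (s + 1), [a, 1].getD r 1} =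
      Ideal.span {c, a} * Ideal.span {c, a} := by
  simp only [Finset.prod_range_succ, Finset.prod_range_zero, one_mul, mul_one, List.getD_cons_zero,
    List.getD_cons_succ]

section SChart

variable {A : Type u} [CommRing A] (uu e₀ y z : A)

local notation3 "cc" => (Fin.cons uu (fun _ : Fin 1 => e₀) : Fin 2 → A)
local notation3 "II" => Ideal.span (Set.range (Fin.cons uu (fun _ : Fin 1 => e₀) : Fin 2 → A))
/-- the `u`-chart («`s`-chart») `C₀`, its structure map, exceptional parameter `w₀`, `s = e₀/u` -/
local notation3 "C₀" => chartRing cc 0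
local notation3 "ψ₀" => chartBase cc 0
local notation3 "w₀" => chartBase cc 0 (cc 0)
local notation3 "ss" => chartGen cc 0 1
/-- the strict transform `h″ = s ψ₀ y + ψ₀ z` of `H = e₀ y + u z` -/
local notation3 "h″" => chartGen cc 0 1 * chartBase cc 0 y + chartBase cc 0 z
/-- the polynomial model `(A/(u,e₀))[S]` of the exceptional divisor `C₀/(w₀)` and the image of `h″` -/
local notation3 "PP₀" => MvPolynomial {j : Fin 2 // j ≠ 0} (A ⧸ II)
local notation3 "h♭" => MvPolynomial.X (⟨1, one_ne_zero_fin2⟩ : {j : Fin 2 // j ≠ 0}) *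
    (MvPolynomial.C (Ideal.Quotient.mk II y) : MvPolynomial {j : Fin 2 // j ≠ 0} (A ⧸ II))
  + MvPolynomial.C (Ideal.Quotient.mk II z)

/-- `w₀` is a non-zero-divisor of the chart. [cite: StacksProject, Tag 0804] -/
theorem w₀_mem_nonZeroDivisors : w₀ ∈ nonZeroDivisors C₀ :=
  reesChartBase_mem_nonZeroDivisors (cc 0) (Ideal.mem_span_range_self (f := cc) (x := 0))

/-- The value of the exceptional-divisor model on `h♭ = S ȳ + z̄`: the class of `h″`. [folklore] -/
theorem chartQuotEquiv_hFlat (hc : IsQuasiRegular cc) :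
    chartQuotEquiv cc 0 hc h♭ = Ideal.Quotient.mk (Ideal.span {w₀}) h″ := by
  rw [chartQuotEquiv_apply, map_add, map_mul, chartQuotMap_C, chartQuotMap_C, chartQuotMap_X]
  simp only [map_add, map_mul]

/-- `h″ ∉ (w₀)` when `S ȳ + z̄ ≠ 0`. [folklore] -/
theorem h_notMem_span_w (hc : IsQuasiRegular cc) (hQ0 : h♭ ≠ 0) : h″ ∉ Ideal.span {w₀} := by
  intro h
  apply hQ0
  apply (chartQuotEquiv cc 0 hc).injective
  rw [chartQuotEquiv_hFlat uu e₀ y z hc, map_zero]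
  exact Ideal.Quotient.eq_zero_iff_mem.mpr h

/-- `(h″) ↦ (class of h″) = (image of h♭)` modulo `w₀`. [folklore] -/
theorem map_mk_span_h_w (hc : IsQuasiRegular cc) :
    (Ideal.span {h″}).map (Ideal.Quotient.mk (Ideal.span {w₀})) =
      (Ideal.span {h♭}).map (chartQuotEquiv cc 0 hc : PP₀ →+* C₀ ⧸ Ideal.span {w₀}) := by
  rw [Ideal.map_span, Set.image_singleton, Ideal.map_span, Set.image_singleton]
  exact congrArg (fun q => Ideal.span {q}) (chartQuotEquiv_hFlat uu e₀ y z hc).symm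

/-- **`C₀ ⧸ (h″, w₀) ≅ (A/(u,e₀))[S] ⧸ (S ȳ + z̄)`.** [cite: StacksProject, Tag 0BIQ] -/
theorem nonempty_quot_span_h_w_equiv (hc : IsQuasiRegular cc) :
    Nonempty ((PP₀ ⧸ Ideal.span {h♭}) ≃+* (C₀ ⧸ Ideal.span {h″, w₀})) := by
  let e := chartQuotEquiv cc 0 hc
  let e1 : (PP₀ ⧸ Ideal.span {h♭}) ≃+*
      ((C₀ ⧸ Ideal.span {w₀}) ⧸ (Ideal.span {h″}).map (Ideal.Quotient.mk (Ideal.span {w₀}))) :=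
    Ideal.quotientEquiv (Ideal.span {h♭}) _ e (map_mk_span_h_w uu e₀ y z hc)
  let e2 : ((C₀ ⧸ Ideal.span {w₀}) ⧸ (Ideal.span {h″}).map (Ideal.Quotient.mk (Ideal.span {w₀}))) ≃+*
      (C₀ ⧸ (Ideal.span {w₀} ⊔ Ideal.span {h″})) :=
    DoubleQuot.quotQuotEquivQuotSup (Ideal.span {w₀}) (Ideal.span {h″})
  have hsup : Ideal.span {w₀} ⊔ Ideal.span {h″} = Ideal.span {h″, w₀} := by
    rw [Ideal.span_insert, sup_comm]
  exact ⟨(e1.trans e2).trans (Ideal.quotEquivOfEq hsup)⟩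

/-- `C₀ ⧸ (h″, w₀)` is a regular ring when `(A/(u,e₀))[S] ⧸ (S ȳ + z̄)` is. [cite: StacksProject, Tag 0BIQ] -/
theorem isRegularRing_quot_span_h_w (hc : IsQuasiRegular cc)
    (hQr : IsRegularRing (PP₀ ⧸ Ideal.span {h♭})) : IsRegularRing (C₀ ⧸ Ideal.span {h″, w₀}) := by
  obtain ⟨e⟩ := nonempty_quot_span_h_w_equiv uu e₀ y z hc
  exact IsRegularRing.of_ringEquiv (R := PP₀ ⧸ Ideal.span {h♭}) e

/-- **`(h″, w₀)` is weakly regular**: `w₀` is a non-zero-divisor, `h̄″ = S ȳ + z̄ ≠ 0` in the domain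
`C₀/(w₀)`, swap. [cite: Matsumura1987, Thm. 16.2 (i)] -/
theorem isWeaklyRegular_h_w (hc : IsQuasiRegular cc) [IsDomain A] [IsDomain (A ⧸ II)] (hu : uu ≠ 0)
    (hQ0 : h♭ ≠ 0) :
    RingTheory.Sequence.IsWeaklyRegular C₀ (List.ofFn (Fin.cons h″ fun _ : Fin 1 => w₀)) := by
  haveI : IsDomain C₀ := isDomain_chartRing cc 0 hu
  haveI : NoZeroDivisors C₀ := IsDomain.to_noZeroDivisors (chartRing cc 0)
  haveI : IsDomain (C₀ ⧸ Ideal.span {w₀}) := isDomain_chartRing_quot_span cc 0 hc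
  have hh := h_notMem_span_w uu e₀ y z hc hQ0
  have hh0 : h″ ∈ nonZeroDivisors C₀ :=
    mem_nonZeroDivisors_of_ne_zero fun h0 => hh (by rw [h0]; exact Ideal.zero_mem _)
  have hmk : Ideal.Quotient.mk (Ideal.span {w₀}) h″ ∈ nonZeroDivisors (C₀ ⧸ Ideal.span {w₀}) :=
    mem_nonZeroDivisors_of_ne_zero fun h0 => hh (Ideal.Quotient.eq_zero_iff_mem.mp h0)
  have h1 : RingTheory.Sequence.IsWeaklyRegular C₀ (List.ofFn (Fin.cons w₀ fun _ : Fin 1 => h″)) :=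
    (isWeaklyRegular_pair_iff _ _).mpr
      ⟨((isRegular_iff_mem_nonZeroDivisors).mpr (w₀_mem_nonZeroDivisors uu e₀)).left.isSMulRegular,
        isSMulRegular_quotient_of_mem_nonZeroDivisors _ _ hmk⟩
  exact isWeaklyRegular_pair_swap _ _ (w₀_mem_nonZeroDivisors uu e₀) hh0 h1

/-- **The two-letter tower on the `s`-chart for ANY word in `{w₀, 1}`.**
[cite: StacksProject, Tag 080A] [cite: Liu2002, Thm. 8.1.19 (a)] -/
theorem isRegular_of_isBlowup_sFlag (hc : IsQuasiRegular cc) (N : ℕ) [IsDomain A] [IsRegularRing A]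
    [IsDomain (A ⧸ II)] [IsRegularRing (A ⧸ II)] (hu : uu ≠ 0)
    (hQr : IsRegularRing (PP₀ ⧸ Ideal.span {h♭})) (hQ0 : h♭ ≠ 0)
    (L : ℕ → C₀) (hL : ∀ r, L r = w₀ ∨ L r = 1)
    {Y : Scheme.{u}} {ρ : Y ⟶ Spec (.of C₀)}
    (hρ : IsBlowup ρ (affineBlowup.idealSheaf (∏ s ∈ Finset.range N,
      Ideal.span {h″, ∏ r ∈ Finset.range (s + 1), L r}))) :
    Scheme.IsRegular Y := by
  haveI : IsRegularRing C₀ := isRegularRing_blowupChart cc 0 hc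
  haveI : IsDomain C₀ := isDomain_chartRing cc 0 hu
  have hhw := isWeaklyRegular_h_w uu e₀ y z hc hu hQ0
  exact isRegular_of_isBlowup_letterTower_two'' N h″ w₀ L hL
    (isQuasiRegular_of_isWeaklyRegular _ hhw) (isRegularRing_quot_span_h_w uu e₀ y z hc hQr)
    (nonZeroDivisors.ne_zero (w₀_mem_nonZeroDivisors uu e₀)) hρ

/-- The image of the three companion factors on the `s`-chart, flag form: `(w₀)³ · (h″, w₀)(h″, w₀·1)`.
[cite: StacksProject, Tag 080B] -/
theorem map_tpProd_s :
    (Ideal.span {e₀ * y, uu} *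
        (Ideal.span {e₀ * y + uu * z} ⊔ Ideal.span {uu} * Ideal.span {e₀} ⊔ Ideal.span {uu} ^ 2) *
        (Ideal.span {e₀ * y + uu * z} ⊔ Ideal.span {uu} ^ 2)).map ψ₀ =
      Ideal.span {w₀} ^ 3 * ∏ s ∈ Finset.range 2,
        Ideal.span {h″, ∏ r ∈ Finset.range (s + 1), [w₀, 1].getD r 1} := by
  have h3 : (Ideal.span {e₀ * y, uu}).map ψ₀ = Ideal.span {w₀} := map_tpA3_s uu e₀ y
  have h4 : (Ideal.span {e₀ * y + uu * z} ⊔ Ideal.span {uu} * Ideal.span {e₀} ⊔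
      Ideal.span {uu} ^ 2).map ψ₀ = Ideal.span {w₀} * Ideal.span {h″, w₀} := map_tpA4_s uu e₀ y z
  have hK : (Ideal.span {e₀ * y + uu * z} ⊔ Ideal.span {uu} ^ 2).map ψ₀ =
      Ideal.span {w₀} * Ideal.span {h″, w₀} := map_tpK_s uu e₀ y z
  rw [Ideal.map_mul, Ideal.map_mul, h3, h4, hK, tp_flag_product_s]
  exact congrArg (Ideal.span {w₀} ^ 3 * ·) (tp_flag_two h″ w₀).symm

/-- **The `s`-chart of the plane blow-up is resolved by the companion factors** whenever the
exceptional curve datum `(A/(u,e₀))[S]/(S ȳ + z̄)` is regular: every blowing up of `Spec C₀` along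
the image of `(e₀y, u) · ((H) + u(e₀) + (u²)) · ((H) + (u²))` is regular.
[cite: StacksProject, Tag 080A] [cite: StacksProject, Tag 080B] [cite: Liu2002, Thm. 8.1.19 (a)] -/
theorem isRegular_of_isBlowup_tpProd_s (hc : IsQuasiRegular cc) [IsDomain A] [IsRegularRing A]
    [IsDomain (A ⧸ II)] [IsRegularRing (A ⧸ II)] (hu : uu ≠ 0)
    (hQr : IsRegularRing (PP₀ ⧸ Ideal.span {h♭})) (hQ0 : h♭ ≠ 0)
    {Y : Scheme.{u}} {ρ : Y ⟶ Spec (.of C₀)}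
    (hρ : IsBlowup ρ (affineBlowup.idealSheaf ((Ideal.span {e₀ * y, uu} *
        (Ideal.span {e₀ * y + uu * z} ⊔ Ideal.span {uu} * Ideal.span {e₀} ⊔ Ideal.span {uu} ^ 2) *
        (Ideal.span {e₀ * y + uu * z} ⊔ Ideal.span {uu} ^ 2)).map ψ₀))) :
    Scheme.IsRegular Y := by
  have hw3 : w₀ ^ 3 ∈ nonZeroDivisors C₀ := pow_mem (w₀_mem_nonZeroDivisors uu e₀) 3
  rw [map_tpProd_s uu e₀ y z, Ideal.span_singleton_pow] at hρ
  exact CoreRungTower.isRegular_of_isBlowup_span_singleton_mul hw3 _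
    (fun Y' ρ' h' => isRegular_of_isBlowup_sFlag uu e₀ y z hc 2 hu hQr hQ0
      (fun r => [w₀, 1].getD r 1) (tp_letters_spec_s w₀) h') hρ

end SChart

end TwoPlanesRung

end Summit.ResolutionOfSingularities.ResolutionOfSingularities.Theorems

end
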